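import Summits.ValiantsHypothesis.ValiantsHypothesis.Theorems.BarrierLeverChowThinRowsLabelledPairs

/-!
# Route BarrierLever — item `ChowHitsThinRowPartitionMinors` (stmt-ValiantsHypothesis-20195):
# the PAIR LAYER on down-closed column families, II — hub rows (one solved variable)

Helper file (`--supports stmt-ValiantsHypothesis-20195`; cell valiant-natproofs, rung V4, 𝒟-side of
door (c); prover seat val-np-p8 gen 0).  Closes NO item; imports only `…ChowThinRowsLabelledPairs`
(this seat; no route file).  Conventions as there (`E u w`, indicator forms `φ_V`, truncated inverses
`t_V`, `B⁰ = ∏_𝒟 φ⁰_V`).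

Beyond union-labelled layouts (file I) the pair layer needs variables whose `x`-coefficients are NOT
concentrated in one form.  The simplest such device is a HUB: one variable `z` whose `t`-coordinates
`κ₅` are SOLVED so that `Σ_V κ₅(V) t_V` is a prescribed `y`-only element `G` (possible because the
`t_V`, `V ∈ 𝒟`, are a basis: `exists_tcoords_eq`), while the other variables stay `x`-diagonal.  Then
(`coeff_hub_row`, `coeff_hubPair_row`) the rows `{z}` and `{a, z}` of the partition matrix are
`B⁰ · G` and `B⁰ · t_{L a} · (G - κ₅(L a) t_{L a})` — again of the shape required by the
triangular-design criterion `det_ne_zero_of_triangularDesign` of file I.  Also two small coefficient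
computations (`coeff_indicatorPoly`, `coeff_tinv_singleton_mul`).  Used by
`…ChowThinRowsCapacityLayout` (the `s = 2` capacity layout `Thin(5) × 2^4`).

WHAT THIS IS NOT: Conjecture DC in general is not proved; nothing on items 20195 / 20172 / 19717
themselves, on crux stmt-ValiantsHypothesis-14610, or on `VP` versus `VNP`.
-/

set_option linter.dupNamespace false

namespace Summit.ValiantsHypothesis.ValiantsHypothesis.Theorems.BarrierLever.ChowSubcube

open Finset MvPolynomial
open Summit.ValiantsHypothesis.ValiantsHypothesis.Theorems.BarrierLever.ChowFactor
  (coeff_partitionExpo_mul_affine coeff_partitionExpo_mul_yOnly totalDegree_affine_le)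
open Summit.ValiantsHypothesis.ValiantsHypothesis.Theorems.BarrierLever.ProductStateSums
  (castAdd_ne_natAdd partitionExpo_apply_castAdd partitionExpo_apply_natAdd)
open Summit.ValiantsHypothesis.ValiantsHypothesis.Theorems.BarrierLever.CorankRepair (partitionExpo_eq_iff)

variable {h : ℕ}

/-! ## 1. Two small coefficient computations -/

/-- Coefficients of an indicator polynomial `Σ_{U' ∈ 𝒟, p U'} y^{U'}`. -/
theorem coeff_indicatorPoly (DD : Finset (Finset (Fin h))) (p : Finset (Fin h) → Prop)
    [DecidablePred p] (U : Finset (Fin h)) :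
    coeff (∑ a ∈ (∅ : Finset (Fin h)), Finsupp.single (Fin.castAdd h a) 1 +
        ∑ c ∈ U, Finsupp.single (Fin.natAdd h c) 1)
        (∑ U' ∈ DD.filter p, monomial (∑ a ∈ (∅ : Finset (Fin h)), Finsupp.single (Fin.castAdd h a) 1 +
          ∑ c ∈ U', Finsupp.single (Fin.natAdd h c) 1) (1 : ℂ)) =
      if U ∈ DD ∧ p U then 1 else 0 := by
  classical
  rw [coeff_sum]
  simp only [coeff_monomial]
  have key : ∀ U' ∈ DD.filter p,
      (if (∑ a ∈ (∅ : Finset (Fin h)), Finsupp.single (Fin.castAdd h a) 1 +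
            ∑ c ∈ U', Finsupp.single (Fin.natAdd h c) 1 : Fin (h + h) →₀ ℕ) =
          ∑ a ∈ (∅ : Finset (Fin h)), Finsupp.single (Fin.castAdd h a) 1 +
            ∑ c ∈ U, Finsupp.single (Fin.natAdd h c) 1
        then (1 : ℂ) else 0) = if U' = U then 1 else 0 := by
    intro U' _
    by_cases hU : U' = U
    · subst hU; simp
    · rw [if_neg, if_neg hU]
      intro e
      exact hU ((partitionExpo_eq_iff ∅ U' ∅ U).mp e).2
  rw [Finset.sum_congr rfl key, Finset.sum_ite_eq']
  simp only [Finset.mem_filter]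

/-- Multiplying any `q` by the truncated inverse `t_{{c}} = 1 - y_c` of a singleton:
`coeff (E ∅ W) (t_{{c}} · q) = coeff (E ∅ W) q - [c ∈ W] · coeff (E ∅ (W.erase c)) q`. -/
theorem coeff_tinv_singleton_mul (c : Fin h) (q : MvPolynomial (Fin (h + h)) ℂ) (W : Finset (Fin h)) :
    coeff (∑ a ∈ (∅ : Finset (Fin h)), Finsupp.single (Fin.castAdd h a) 1 +
        ∑ c' ∈ W, Finsupp.single (Fin.natAdd h c') 1)
        ((∑ U ∈ ({c} : Finset (Fin h)).powerset, monomial (∑ a ∈ (∅ : Finset (Fin h)),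
          Finsupp.single (Fin.castAdd h a) 1 + ∑ c' ∈ U, Finsupp.single (Fin.natAdd h c') 1)
          ((-1 : ℂ) ^ U.card * (U.card.factorial : ℂ))) * q) =
      coeff (∑ a ∈ (∅ : Finset (Fin h)), Finsupp.single (Fin.castAdd h a) 1 +
          ∑ c' ∈ W, Finsupp.single (Fin.natAdd h c') 1) q -
        (if c ∈ W then coeff (∑ a ∈ (∅ : Finset (Fin h)), Finsupp.single (Fin.castAdd h a) 1 +
          ∑ c' ∈ W.erase c, Finsupp.single (Fin.natAdd h c') 1) q else 0) := by
  classical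
  rw [mul_comm, coeff_partitionExpo_mul_yOnly _ _ (yOnly_tinv {c}) ∅ W]
  simp_rw [coeff_tinv, mul_ite, mul_zero]
  rw [← Finset.sum_filter]
  by_cases hc : c ∈ W
  · have hfil : W.powerset.filter (fun U => U ⊆ {c}) = {∅, {c}} := by
      ext U
      simp only [Finset.mem_filter, Finset.mem_powerset, Finset.mem_insert, Finset.mem_singleton,
        Finset.subset_singleton_iff]
      constructor
      · rintro ⟨-, h⟩; exact h
      · rintro (rfl | rfl)
        · exact ⟨Finset.empty_subset _, Or.inl rfl⟩
        · exact ⟨Finset.singleton_subset_iff.mpr hc, Or.inr rfl⟩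
    rw [hfil, Finset.sum_pair (Finset.singleton_ne_empty c).symm, if_pos hc, Finset.sdiff_empty,
      Finset.sdiff_singleton_eq_erase, Finset.card_empty, Finset.card_singleton]
    simp only [pow_zero, Nat.factorial_zero, Nat.factorial_one, Nat.cast_one, mul_one, pow_one]
    ring
  · have hfil : W.powerset.filter (fun U => U ⊆ {c}) = {∅} := by
      ext U
      simp only [Finset.mem_filter, Finset.mem_powerset, Finset.mem_singleton,
        Finset.subset_singleton_iff]
      constructor
      · rintro ⟨hUW, h | h⟩
        · exact h
        · exfalso; exact hc (hUW (h ▸ Finset.mem_singleton_self c))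
      · rintro rfl; exact ⟨Finset.empty_subset _, Or.inl rfl⟩
    rw [hfil, Finset.sum_singleton, if_neg hc, Finset.sdiff_empty, Finset.card_empty]
    simp

/-! ## 2. Hub rows: one solved variable against `x`-diagonal ones -/

/-- **Hub singleton row.**  If the variable `z` has `x`-coefficients `κ_z = κ₅` on `𝒟` and
`Σ_V κ₅(V) t_V = G` on the squarefree monomials of `𝒟` (a SOLVED variable), then the row `{z}` of
the partition matrix of `∏_𝒟 φ` is `B⁰ · G` on `𝒟`. -/
theorem coeff_hub_row (DD : Finset (Finset (Fin h)))
    (hDD : ∀ W ∈ DD, ∀ U : Finset (Fin h), U ⊆ W → U ∈ DD)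
    (κ : Fin h → Finset (Fin h) → ℂ) (z : Fin h) (κ₅ : Finset (Fin h) → ℂ)
    (hκz : ∀ V ∈ DD, κ z V = κ₅ V) (G : MvPolynomial (Fin (h + h)) ℂ)
    (hG : ∀ s ∈ G.support, ∀ a : Fin h, s (Fin.castAdd h a) = 0)
    (hsolve : ∀ U ∈ DD, ∑ V ∈ DD, κ₅ V * coeff (∑ a ∈ (∅ : Finset (Fin h)), Finsupp.single (Fin.castAdd h a) 1 +
        ∑ c ∈ U, Finsupp.single (Fin.natAdd h c) 1)
        (∑ U' ∈ V.powerset, monomial (∑ a ∈ (∅ : Finset (Fin h)), Finsupp.single (Fin.castAdd h a) 1 +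
          ∑ c ∈ U', Finsupp.single (Fin.natAdd h c) 1) ((-1 : ℂ) ^ U'.card * (U'.card.factorial : ℂ))) =
      coeff (∑ a ∈ (∅ : Finset (Fin h)), Finsupp.single (Fin.castAdd h a) 1 +
        ∑ c ∈ U, Finsupp.single (Fin.natAdd h c) 1) G)
    (W : Finset (Fin h)) (hW : W ∈ DD) :
    coeff (∑ a ∈ ({z} : Finset (Fin h)), Finsupp.single (Fin.castAdd h a) 1 +
        ∑ c ∈ W, Finsupp.single (Fin.natAdd h c) 1)
        (∏ V ∈ DD, (C 1 + ∑ a, C (κ a V) * X (Fin.castAdd h a) +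
          ∑ c, C (if c ∈ V then (1 : ℂ) else 0) * X (Fin.natAdd h c))) =
      coeff (∑ a ∈ (∅ : Finset (Fin h)), Finsupp.single (Fin.castAdd h a) 1 +
          ∑ c ∈ W, Finsupp.single (Fin.natAdd h c) 1)
        ((∏ V' ∈ DD, (C 1 + ∑ a, C ((fun (_ : Fin h) (_ : Finset (Fin h)) => (0 : ℂ)) a V') *
            X (Fin.castAdd h a) + ∑ c, C (if c ∈ V' then (1 : ℂ) else 0) * X (Fin.natAdd h c))) * G) := by
  classical
  rw [coeff_single_prod κ DD z W]
  have hstep : ∀ V ∈ DD, κ z V *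
      coeff (∑ a' ∈ (∅ : Finset (Fin h)), Finsupp.single (Fin.castAdd h a') 1 +
          ∑ c ∈ W, Finsupp.single (Fin.natAdd h c) 1)
        (∏ V' ∈ DD.erase V, (C 1 + ∑ a, C (κ a V') * X (Fin.castAdd h a) +
          ∑ c, C (if c ∈ V' then (1 : ℂ) else 0) * X (Fin.natAdd h c))) =
      ∑ U ∈ W.powerset, coeff (∑ a ∈ (∅ : Finset (Fin h)), Finsupp.single (Fin.castAdd h a) 1 +
            ∑ c ∈ W \ U, Finsupp.single (Fin.natAdd h c) 1)
          (∏ V' ∈ DD, (C 1 + ∑ a, C ((fun (_ : Fin h) (_ : Finset (Fin h)) => (0 : ℂ)) a V') *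
            X (Fin.castAdd h a) + ∑ c, C (if c ∈ V' then (1 : ℂ) else 0) * X (Fin.natAdd h c))) *
        (κ₅ V * coeff (∑ a ∈ (∅ : Finset (Fin h)), Finsupp.single (Fin.castAdd h a) 1 +
            ∑ c ∈ U, Finsupp.single (Fin.natAdd h c) 1)
          (∑ U' ∈ V.powerset, monomial (∑ a ∈ (∅ : Finset (Fin h)), Finsupp.single (Fin.castAdd h a) 1 +
            ∑ c ∈ U', Finsupp.single (Fin.natAdd h c) 1) ((-1 : ℂ) ^ U'.card * (U'.card.factorial : ℂ)))) := by
    intro V hV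
    rw [hκz V hV, coeff_empty_prod_eq κ (fun _ _ => (0 : ℂ)) (DD.erase V) W,
      coeff_leaveOneOut DD V hV W, Finset.mul_sum]
    refine Finset.sum_congr rfl fun U _ => ?_
    ring
  rw [Finset.sum_congr rfl hstep, Finset.sum_comm, coeff_partitionExpo_mul_yOnly _ _ hG ∅ W]
  refine Finset.sum_congr rfl fun U hU => ?_
  rw [← Finset.mul_sum, hsolve U (hDD W hW U (Finset.mem_powerset.mp hU))]

/-- **Hub pair row.**  With `z` solved as in `coeff_hub_row` and `a ≠ z` an `x`-diagonal variable
(`κ_a(V) = [V = L_a]`, `L_a ∈ 𝒟`), the row `{a, z}` of the partition matrix of `∏_𝒟 φ` is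
`B⁰ · t_{L_a} · (G - κ₅(L_a) t_{L_a})` on `𝒟`. -/
theorem coeff_hubPair_row (DD : Finset (Finset (Fin h)))
    (hDD : ∀ W ∈ DD, ∀ U : Finset (Fin h), U ⊆ W → U ∈ DD)
    (κ : Fin h → Finset (Fin h) → ℂ) (z : Fin h) (κ₅ : Finset (Fin h) → ℂ)
    (hκz : ∀ V ∈ DD, κ z V = κ₅ V) (G : MvPolynomial (Fin (h + h)) ℂ)
    (hG : ∀ s ∈ G.support, ∀ a : Fin h, s (Fin.castAdd h a) = 0)
    (hsolve : ∀ U ∈ DD, ∑ V ∈ DD, κ₅ V * coeff (∑ a ∈ (∅ : Finset (Fin h)), Finsupp.single (Fin.castAdd h a) 1 +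
        ∑ c ∈ U, Finsupp.single (Fin.natAdd h c) 1)
        (∑ U' ∈ V.powerset, monomial (∑ a ∈ (∅ : Finset (Fin h)), Finsupp.single (Fin.castAdd h a) 1 +
          ∑ c ∈ U', Finsupp.single (Fin.natAdd h c) 1) ((-1 : ℂ) ^ U'.card * (U'.card.factorial : ℂ))) =
      coeff (∑ a ∈ (∅ : Finset (Fin h)), Finsupp.single (Fin.castAdd h a) 1 +
        ∑ c ∈ U, Finsupp.single (Fin.natAdd h c) 1) G)
    (a : Fin h) (haz : a ≠ z) (La : Finset (Fin h)) (hLa : La ∈ DD)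
    (hκa : ∀ V ∈ DD, κ a V = if V = La then 1 else 0)
    (W : Finset (Fin h)) (hW : W ∈ DD) :
    coeff (∑ a' ∈ ({a, z} : Finset (Fin h)), Finsupp.single (Fin.castAdd h a') 1 +
        ∑ c ∈ W, Finsupp.single (Fin.natAdd h c) 1)
        (∏ V ∈ DD, (C 1 + ∑ a, C (κ a V) * X (Fin.castAdd h a) +
          ∑ c, C (if c ∈ V then (1 : ℂ) else 0) * X (Fin.natAdd h c))) =
      coeff (∑ a ∈ (∅ : Finset (Fin h)), Finsupp.single (Fin.castAdd h a) 1 +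
          ∑ c ∈ W, Finsupp.single (Fin.natAdd h c) 1)
        ((∏ V' ∈ DD, (C 1 + ∑ a, C ((fun (_ : Fin h) (_ : Finset (Fin h)) => (0 : ℂ)) a V') *
            X (Fin.castAdd h a) + ∑ c, C (if c ∈ V' then (1 : ℂ) else 0) * X (Fin.natAdd h c))) *
          ((∑ U ∈ La.powerset, monomial (∑ a' ∈ (∅ : Finset (Fin h)), Finsupp.single (Fin.castAdd h a') 1 +
              ∑ c ∈ U, Finsupp.single (Fin.natAdd h c) 1) ((-1 : ℂ) ^ U.card * (U.card.factorial : ℂ))) *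
            (G + C (-κ₅ La) * ∑ U ∈ La.powerset, monomial (∑ a' ∈ (∅ : Finset (Fin h)),
              Finsupp.single (Fin.castAdd h a') 1 + ∑ c ∈ U, Finsupp.single (Fin.natAdd h c) 1)
              ((-1 : ℂ) ^ U.card * (U.card.factorial : ℂ))))) := by
  classical
  rw [coeff_pair_prod κ DD haz W]
  have hsum : ∀ V ∈ DD, κ a V *
      coeff (∑ a' ∈ ({z} : Finset (Fin h)), Finsupp.single (Fin.castAdd h a') 1 +
          ∑ c ∈ W, Finsupp.single (Fin.natAdd h c) 1)
        (∏ V' ∈ DD.erase V, (C 1 + ∑ a, C (κ a V') * X (Fin.castAdd h a) +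
          ∑ c, C (if c ∈ V' then (1 : ℂ) else 0) * X (Fin.natAdd h c))) =
      if V = La then coeff (∑ a' ∈ ({z} : Finset (Fin h)), Finsupp.single (Fin.castAdd h a') 1 +
          ∑ c ∈ W, Finsupp.single (Fin.natAdd h c) 1)
        (∏ V' ∈ DD.erase V, (C 1 + ∑ a, C (κ a V') * X (Fin.castAdd h a) +
          ∑ c, C (if c ∈ V' then (1 : ℂ) else 0) * X (Fin.natAdd h c))) else 0 := by
    intro V hV
    rw [hκa V hV]
    split_ifs <;> simp
  rw [Finset.sum_congr rfl hsum, Finset.sum_ite_eq' DD La, if_pos hLa,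
    coeff_single_prod κ (DD.erase La) z W]
  -- the leave-one-out design over `DD.erase La`
  have hstep : ∀ V ∈ DD.erase La, κ z V *
      coeff (∑ a' ∈ (∅ : Finset (Fin h)), Finsupp.single (Fin.castAdd h a') 1 +
          ∑ c ∈ W, Finsupp.single (Fin.natAdd h c) 1)
        (∏ V' ∈ (DD.erase La).erase V, (C 1 + ∑ a, C (κ a V') * X (Fin.castAdd h a) +
          ∑ c, C (if c ∈ V' then (1 : ℂ) else 0) * X (Fin.natAdd h c))) =
      ∑ U ∈ W.powerset, coeff (∑ a ∈ (∅ : Finset (Fin h)), Finsupp.single (Fin.castAdd h a) 1 +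
            ∑ c ∈ W \ U, Finsupp.single (Fin.natAdd h c) 1)
          (∏ V' ∈ DD.erase La, (C 1 + ∑ a, C ((fun (_ : Fin h) (_ : Finset (Fin h)) => (0 : ℂ)) a V') *
            X (Fin.castAdd h a) + ∑ c, C (if c ∈ V' then (1 : ℂ) else 0) * X (Fin.natAdd h c))) *
        (κ₅ V * coeff (∑ a ∈ (∅ : Finset (Fin h)), Finsupp.single (Fin.castAdd h a) 1 +
            ∑ c ∈ U, Finsupp.single (Fin.natAdd h c) 1)
          (∑ U' ∈ V.powerset, monomial (∑ a ∈ (∅ : Finset (Fin h)), Finsupp.single (Fin.castAdd h a) 1 +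
            ∑ c ∈ U', Finsupp.single (Fin.natAdd h c) 1) ((-1 : ℂ) ^ U'.card * (U'.card.factorial : ℂ)))) := by
    intro V hV
    rw [hκz V (Finset.mem_of_mem_erase hV),
      coeff_empty_prod_eq κ (fun _ _ => (0 : ℂ)) ((DD.erase La).erase V) W,
      coeff_leaveOneOut (DD.erase La) V hV W, Finset.mul_sum]
    refine Finset.sum_congr rfl fun U _ => ?_
    ring
  rw [Finset.sum_congr rfl hstep, Finset.sum_comm]
  -- the right-hand side
  have hQy : ∀ s ∈ (G + C (-κ₅ La) * ∑ U ∈ La.powerset, monomial (∑ a' ∈ (∅ : Finset (Fin h)),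
      Finsupp.single (Fin.castAdd h a') 1 + ∑ c ∈ U, Finsupp.single (Fin.natAdd h c) 1)
      ((-1 : ℂ) ^ U.card * (U.card.factorial : ℂ))).support, ∀ a : Fin h, s (Fin.castAdd h a) = 0 := by
    refine yOnly_add hG (yOnly_mul ?_ (yOnly_tinv La))
    rw [C_apply]
    exact yOnly_monomial 0 _ fun _ => rfl
  rw [← mul_assoc, coeff_partitionExpo_mul_yOnly _ _ hQy ∅ W]
  refine Finset.sum_congr rfl fun U hU => ?_
  have hUD : U ∈ DD := hDD W hW U (Finset.mem_powerset.mp hU)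
  rw [coeff_leaveOneOut DD La hLa (W \ U), ← coeff_partitionExpo_mul_yOnly _ _ (yOnly_tinv La) ∅ (W \ U),
    ← Finset.mul_sum, coeff_add, coeff_C_mul, ← hsolve U hUD, ← Finset.add_sum_erase DD _ hLa]
  ring

/-! ## 3. Solving one variable in the `t`-basis -/

/-- **The truncated inverses are a basis (solving a variable).**  If `w` enumerates all of a
down-closed family `𝒟` injectively and sorted by cardinality, then for every target `τ` there are
`t`-coordinates `κ₅` with `Σ_{V ∈ 𝒟} κ₅(V) · coeff_{y^{w l}} t_V = τ l` for all `l` (the matrix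
`[coeff_{y^{w l}} t_{w k}]` is lower triangular with diagonal `(-1)^{|w k|} |w k|! ≠ 0`). -/
theorem exists_tcoords_eq (DD : Finset (Finset (Fin h))) (r : ℕ) (w : Fin r → Finset (Fin h))
    (hw : Function.Injective w) (hwD : ∀ j, w j ∈ DD) (hsurj : ∀ V ∈ DD, ∃ j, w j = V)
    (hmono : Monotone fun j => (w j).card) (τ : Fin r → ℂ) :
    ∃ κ₅ : Finset (Fin h) → ℂ, ∀ l : Fin r, ∑ V ∈ DD, κ₅ V *
      coeff (∑ a ∈ (∅ : Finset (Fin h)), Finsupp.single (Fin.castAdd h a) 1 +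
          ∑ c ∈ w l, Finsupp.single (Fin.natAdd h c) 1)
        (∑ U' ∈ V.powerset, monomial (∑ a ∈ (∅ : Finset (Fin h)), Finsupp.single (Fin.castAdd h a) 1 +
          ∑ c ∈ U', Finsupp.single (Fin.natAdd h c) 1) ((-1 : ℂ) ^ U'.card * (U'.card.factorial : ℂ))) = τ l := by
  classical
  set Θ : Matrix (Fin r) (Fin r) ℂ := Matrix.of fun k l =>
    coeff (∑ a ∈ (∅ : Finset (Fin h)), Finsupp.single (Fin.castAdd h a) 1 +
        ∑ c ∈ w l, Finsupp.single (Fin.natAdd h c) 1)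
      (∑ U' ∈ (w k).powerset, monomial (∑ a ∈ (∅ : Finset (Fin h)), Finsupp.single (Fin.castAdd h a) 1 +
        ∑ c ∈ U', Finsupp.single (Fin.natAdd h c) 1) ((-1 : ℂ) ^ U'.card * (U'.card.factorial : ℂ))) with hΘ
  have hΘtri : Θ.BlockTriangular OrderDual.toDual := by
    intro k l hkl
    have hkl' : k < l := hkl
    simp only [hΘ, Matrix.of_apply, coeff_tinv]
    rw [if_neg]
    intro hsub
    have hle : (w k).card ≤ (w l).card := hmono (le_of_lt hkl')
    exact (ne_of_lt hkl') (hw (Finset.eq_of_subset_of_card_le hsub hle)).symm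
  have hΘdet : Θ.det ≠ 0 := by
    rw [Matrix.det_of_lowerTriangular Θ hΘtri]
    refine Finset.prod_ne_zero_iff.mpr fun k _ => ?_
    simp only [hΘ, Matrix.of_apply, coeff_tinv, if_pos (subset_refl _)]
    exact mul_ne_zero (pow_ne_zero _ (by norm_num)) (by exact_mod_cast (w k).card.factorial_ne_zero)
  have hunit : IsUnit Θ := (Matrix.isUnit_iff_isUnit_det Θ).mpr (isUnit_iff_ne_zero.mpr hΘdet)
  obtain ⟨v, hv⟩ := Matrix.vecMul_surjective_iff_isUnit.mpr hunit τ
  refine ⟨fun V => if hV : ∃ k, w k = V then v (Classical.choose hV) else 0, fun l => ?_⟩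
  have hDDim : DD = Finset.univ.image w := by
    ext V
    constructor
    · intro hV
      obtain ⟨j, hj⟩ := hsurj V hV
      exact Finset.mem_image.mpr ⟨j, Finset.mem_univ _, hj⟩
    · intro hV
      obtain ⟨j, -, rfl⟩ := Finset.mem_image.mp hV
      exact hwD j
  rw [hDDim, Finset.sum_image fun k _ k' _ e => hw e]
  have e := congr_fun hv l
  change ∑ k, v k * Θ k l = τ l at e
  rw [← e]
  refine Finset.sum_congr rfl fun k _ => ?_
  have hk : ∃ k', w k' = w k := ⟨k, rfl⟩
  dsimp only
  rw [dif_pos hk, hw (Classical.choose_spec hk)]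
  simp only [hΘ, Matrix.of_apply]

end Summit.ValiantsHypothesis.ValiantsHypothesis.Theorems.BarrierLever.ChowSubcube
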